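import Summits.AnomalousDissipation.AnomalousDissipation.Theorems.SawtoothPulseCascadeK1LocalisedCascadeLedgerSharp
import Summits.AnomalousDissipation.AnomalousDissipation.Theorems.SawtoothPulseCascadeK1LocalisedCascadeLagGe

/-!
# K1loc, line `Spectral` / SeqCone — helper: THE GEOMETRICALLY DECAYING LEDGER ⇒ THE STUB'S CONCLUSION (top assembly)

Helper file of the prover lane on the crux `K1LocalisedCascade` (stmt-AnomalousDissipation-19491), route
`SawtoothPulseCascade` (S-B/S-C assembly seat).  `…K1Ledger.highModeConcentration_of_ledger_threshold` turns a tracked-symbol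
ledger into the body of the registered stub `stub_highModeConcentration`; its inputs are partial-sum bounds `E`, `Z`, a
`κ`-threshold carrying the lag conditions, and a start bound.  This file fixes the TWO-SOCKET interface in which the concrete
cascade ledger (S-B: the per-half-slot plugs of `…K1Ledger.cascade_ledger_step_H'/V'`) and the first good piece (S-D:
`…K1Start.sqrt_tsum_symbol_sq_le_of_inviscid`) are delivered, and does the remaining bookkeeping once:
* §1 `sum_Ico_le_of_le_geometric` — per-phase errors dominated by `K θ^j` from phase `i₀` on have partial sums
  `≤ K θ^{i₀}/(1 − θ)`; `sqrt_sq_add_le` — `√((q+η)² + Z) ≤ √(q² + Z) + η`; `sq_add_le_sq_add` — monotonicity of the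
  energy form `(x+ε)² + ζ` in `(ε, ζ)`.
* §2 **`highModeConcentration_of_geometric_ledger`** — data: cascade parameters `P`, rates `1 < r < ρ`, a radius scale
  `c > 0`, a datum `θ₀ ≠ 0`; symbol families `μᴴ, μⱽ : ℕ → ℤ² → ℝ` with `|μᴴ| ≤ 1` and `μᴴ_J(k)² ≥ 1` on the low horizontal
  block `|k₀| < cρ^J` for `J ≥ i₀`; LEDGER SOCKET: non-negative per-half-slot errors `εᴴ, εⱽ` (amplitudes), `ζᴴ, ζⱽ`
  (energies) with `εᴴ_j + εⱽ_j ≤ K_ε θ^j`, `ζᴴ_j + ζⱽ_j ≤ K_ζ θ^j` for `j ≥ i₀` (`0 ≤ θ < 1`) and the energy-form inequalities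
  asked ONLY for `0 < κ ≤ κ₂` and the phases `i₀ ≤ j < J_r(κ)` (so the dischargers may use `κ·r^{2j} < 1`,
  `…K1Ledger.mul_pow_lt_pow_of_lt_Jrate_add` with `A = 0`, to make the slot-lemma terms `κ`-free); START SOCKET in limit
  form: for every `η > 0` a threshold `κ₁(η) > 0` below which `‖μᴴ_{i₀}(D) w(tStart i₀)‖ ≤ q + η` (exactly what
  `…K1Start.sqrt_tsum_symbol_sq_le_of_inviscid` delivers from a bound `q` on ONE inviscid iterate, `κ₁` free); BUDGET
  `√(q² + K_ζθ^{i₀}/(1−θ)) + K_εθ^{i₀}/(1−θ) < ‖θ₀‖_{L²}`.  Conclusion: the body of `stub_highModeConcentration` for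
  `(P, r, θ₀)` (lag `A = 0`, `K = cρ^{J_r(κ)}`, `κ₀ = min` of the three thresholds, via `…K1Ledger.exists_kappa_threshold`).
* §3 `highModeConcentration_of_geometric_ledger'` — the same with the ledger socket in the EXISTENTIAL per-slot form
  (`∃ ε ζ ≥ 0, ε ≤ K θ^j ∧ ζ ≤ K′ θ^j ∧ …`), which is how a per-phase plug with `κ`- and `w`-dependent error terms reads.
Parameter-agnostic (any `P`, `r`, `θ₀`); under a restatement with symbolic `δ₀` it is used verbatim.  WHAT THIS IS NOT: no
statement about the two sockets; no definitions; nothing about the stub itself is claimed.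
[cite: DEIJ2022, (1.2)–(1.3) (κ-uniform dissipated fraction by the threshold phase)] [cite: Grafakos2014, Prop. 3.2.7 (3)] [problem: turb]
-/

-- `Summit.<Summit>.<Problem>`: single-conjunct summit, the duplicate namespace segment is deliberate.
set_option linter.dupNamespace false

noncomputable section

namespace Summit.AnomalousDissipation.AnomalousDissipation.Theorems.SawtoothPulseCascade.K1Ledger

open MeasureTheory Set Filter Topology UnitAddTorus Function
open scoped ENNReal
open Literature.Analysis Literature.Analysis.FunctionSpaces Literature.Analysis.FunctionSpaces.Torus
open Literature.Analysis.FluidPDE.Torus (highModeEnergy)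
open Literature.Analysis.FluidPDE.SawtoothCascade Literature.Analysis.FluidPDE.SawtoothCascade.CascadeParams

/-! ## §1 Bookkeeping -/

/-- **Geometric domination of partial sums.**  If `f j ≤ K θ^j` for `j ≥ i₀` with `0 ≤ K`, `0 ≤ θ < 1`, then every
partial sum from `i₀` is at most `K θ^{i₀}/(1 − θ)`. [folklore] -/
theorem sum_Ico_le_of_le_geometric {f : ℕ → ℝ} {K θ : ℝ} (hK : 0 ≤ K) (hθ0 : 0 ≤ θ) (hθ1 : θ < 1) {i₀ : ℕ}
    (hf : ∀ j, i₀ ≤ j → f j ≤ K * θ ^ j) (n : ℕ) :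
    ∑ j ∈ Finset.Ico i₀ n, f j ≤ K * θ ^ i₀ / (1 - θ) := by
  have h1 : ∑ j ∈ Finset.Ico i₀ n, f j ≤ ∑ j ∈ Finset.Ico i₀ n, K * θ ^ j :=
    Finset.sum_le_sum fun j hj => hf j (Finset.mem_Ico.1 hj).1
  refine h1.trans ?_
  rw [← Finset.mul_sum, mul_div_assoc]
  exact mul_le_mul_of_nonneg_left (geom_sum_Ico_le_of_lt_one hθ0 hθ1) hK

/-- `√((q+η)² + Z) ≤ √(q² + Z) + η` for `q, η, Z ≥ 0` (the Euclidean norm on `ℝ²` is `1`-Lipschitz in the first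
coordinate). [folklore] -/
theorem sqrt_sq_add_le {q η Z : ℝ} (hq : 0 ≤ q) (hη : 0 ≤ η) (hZ : 0 ≤ Z) :
    Real.sqrt ((q + η) ^ 2 + Z) ≤ Real.sqrt (q ^ 2 + Z) + η := by
  have hs : 0 ≤ Real.sqrt (q ^ 2 + Z) := Real.sqrt_nonneg _
  have hs2 : Real.sqrt (q ^ 2 + Z) ^ 2 = q ^ 2 + Z := Real.sq_sqrt (by positivity)
  have hqs : q ≤ Real.sqrt (q ^ 2 + Z) := by
    rw [show q = Real.sqrt (q ^ 2) by rw [Real.sqrt_sq hq]]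
    exact Real.sqrt_le_sqrt (by rw [Real.sq_sqrt (sq_nonneg q)]; linarith)
  rw [show Real.sqrt (q ^ 2 + Z) + η = Real.sqrt ((Real.sqrt (q ^ 2 + Z) + η) ^ 2) by
    rw [Real.sqrt_sq (by positivity)]]
  exact Real.sqrt_le_sqrt (by nlinarith)

/-- Monotonicity of the energy form: `(x+ε)² + ζ ≤ (x+ε')² + ζ'` for `0 ≤ x`, `0 ≤ ε ≤ ε'`, `ζ ≤ ζ'`. [folklore] -/
theorem sq_add_le_sq_add {x ε ε' ζ ζ' : ℝ} (hx : 0 ≤ x) (hε : 0 ≤ ε) (hεε : ε ≤ ε') (hζζ : ζ ≤ ζ') :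
    (x + ε) ^ 2 + ζ ≤ (x + ε') ^ 2 + ζ' := by
  nlinarith

/-! ## §2 The geometrically decaying ledger gives the stub's conclusion -/

/-- **The geometrically decaying ledger gives the stub's conclusion.**  See the module docstring (§2) for the data.  With
`E = K_εθ^{i₀}/(1−θ)`, `Z = K_ζθ^{i₀}/(1−θ)`, `η = (‖θ₀‖ − √(q²+Z) − E)/2 > 0`, `q₀ = q + η`, the thresholds `κ₁(η)`
(start), `κ₂` (ledger) and `κ₃` (`…K1Ledger.exists_kappa_threshold`: `i₀ ≤ J_r(κ)` and `1 ≤ 8π²κ(cρ^{J_r(κ)})²·tHalf J_r(κ)`),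
this is `…K1Ledger.highModeConcentration_of_ledger_threshold` at `A = 0`, `M = 1`, `κ₀ = min κ₁ (min κ₂ κ₃)`.
[cite: DEIJ2022, (1.2)–(1.3)] [cite: Grafakos2014, Prop. 3.2.7 (3)] -/
theorem highModeConcentration_of_geometric_ledger (P : CascadeParams) {r ρ c : ℝ} (hr : 1 < r) (hρ : r < ρ)
    (hc : 0 < c) {θ₀ : UnitAddTorus (Fin 2) → ℝ} (hθ₀ : 0 < FluidPDE.Torus.scalarL2Sq θ₀)
    (μH μV : ℕ → (Fin 2 → ℤ) → ℝ) (hμH : ∀ j k, |μH j k| ≤ 1) {i₀ : ℕ}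
    (hlow : ∀ J, i₀ ≤ J → ∀ k : Fin 2 → ℤ, |((k 0 : ℤ) : ℝ)| < c * ρ ^ J → 1 ≤ μH J k ^ 2)
    {εH εV ζH ζV : ℕ → ℝ} (hεH : ∀ j, 0 ≤ εH j) (hεV : ∀ j, 0 ≤ εV j) (hζH : ∀ j, 0 ≤ ζH j) (hζV : ∀ j, 0 ≤ ζV j)
    {Kε Kζ θ : ℝ} (hKε : 0 ≤ Kε) (hKζ : 0 ≤ Kζ) (hθ0 : 0 ≤ θ) (hθ1 : θ < 1)
    (hεK : ∀ j, i₀ ≤ j → εH j + εV j ≤ Kε * θ ^ j) (hζK : ∀ j, i₀ ≤ j → ζH j + ζV j ≤ Kζ * θ ^ j)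
    {κ₂ : ℝ} (hκ₂ : 0 < κ₂)
    (hstepH : ∀ κ ∈ Ioc (0 : ℝ) κ₂, ∀ w : ℝ → UnitAddTorus (Fin 2) → ℝ,
      FluidPDE.Torus.IsClassicalScalarTransportOn (Ico 0 1) κ P.field w → w 0 = θ₀ →
        ∀ j, i₀ ≤ j → j < Jrate r κ →
          ∑' k, μV j k ^ 2 * ‖mFourierCoeff (fun x => (w (tStart j + tHalf j) x : ℂ)) k‖ ^ 2 ≤
            (Real.sqrt (∑' k, μH j k ^ 2 * ‖mFourierCoeff (fun x => (w (tStart j) x : ℂ)) k‖ ^ 2) + εH j) ^ 2 + ζH j)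
    (hstepV : ∀ κ ∈ Ioc (0 : ℝ) κ₂, ∀ w : ℝ → UnitAddTorus (Fin 2) → ℝ,
      FluidPDE.Torus.IsClassicalScalarTransportOn (Ico 0 1) κ P.field w → w 0 = θ₀ →
        ∀ j, i₀ ≤ j → j < Jrate r κ →
          ∑' k, μH (j + 1) k ^ 2 * ‖mFourierCoeff (fun x => (w (tStart (j + 1)) x : ℂ)) k‖ ^ 2 ≤
            (Real.sqrt (∑' k, μV j k ^ 2 * ‖mFourierCoeff (fun x => (w (tStart j + tHalf j) x : ℂ)) k‖ ^ 2) + εV j) ^ 2 +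
              ζV j)
    {q : ℝ} (hq : 0 ≤ q)
    (hstart : ∀ η : ℝ, 0 < η → ∃ κ₁ : ℝ, 0 < κ₁ ∧ ∀ κ ∈ Ioc (0 : ℝ) κ₁, ∀ w : ℝ → UnitAddTorus (Fin 2) → ℝ,
      FluidPDE.Torus.IsClassicalScalarTransportOn (Ico 0 1) κ P.field w → w 0 = θ₀ →
        Real.sqrt (∑' k, μH i₀ k ^ 2 * ‖mFourierCoeff (fun x => (w (tStart i₀) x : ℂ)) k‖ ^ 2) ≤ q + η)
    (hbudget : Real.sqrt (q ^ 2 + Kζ * θ ^ i₀ / (1 - θ)) + Kε * θ ^ i₀ / (1 - θ) <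
      Real.sqrt (FluidPDE.Torus.scalarL2Sq θ₀)) :
    ∃ χ : ℝ, 0 < χ ∧ ∃ A' : ℕ, ∃ κ₀ : ℝ, 0 < κ₀ ∧ ∀ κ ∈ Ioc (0 : ℝ) κ₀,
      ∀ w : ℝ → UnitAddTorus (Fin 2) → ℝ,
        FluidPDE.Torus.IsClassicalScalarTransportOn (Ico 0 1) κ P.field w → w 0 = θ₀ →
        ∃ K : ℝ, 0 ≤ K ∧ 1 ≤ 8 * Real.pi ^ 2 * κ * K ^ 2 * tHalf (Jrate r κ + A') ∧
          ENNReal.ofReal (2 * χ * FluidPDE.Torus.scalarL2Sq θ₀) ≤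
            highModeEnergy 0 K (w (tStart (Jrate r κ + A'))) +
              2 * FluidPDE.Torus.eScalarDissipation κ w 0 (tStart (Jrate r κ + A')) := by
  have hρ0 : 0 ≤ ρ := by linarith
  have h1θ : 0 < 1 - θ := by linarith
  -- the closed-form partial-sum bounds
  set E : ℝ := Kε * θ ^ i₀ / (1 - θ) with hEdef
  set Z : ℝ := Kζ * θ ^ i₀ / (1 - θ) with hZdef
  have hZ0 : 0 ≤ Z := by positivity
  have hE : ∀ n, ∑ j ∈ Finset.Ico i₀ n, (εH j + εV j) ≤ E := fun n =>
    sum_Ico_le_of_le_geometric (f := fun j => εH j + εV j) hKε hθ0 hθ1 hεK n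
  have hZ : ∀ n, ∑ j ∈ Finset.Ico i₀ n, (ζH j + ζV j) ≤ Z := fun n =>
    sum_Ico_le_of_le_geometric (f := fun j => ζH j + ζV j) hKζ hθ0 hθ1 hζK n
  -- the margin `η` and the start bound `q₀ = q + η`
  set η : ℝ := (Real.sqrt (FluidPDE.Torus.scalarL2Sq θ₀) - (Real.sqrt (q ^ 2 + Z) + E)) / 2 with hηdef
  have hη : 0 < η := by rw [hηdef]; linarith
  obtain ⟨κ₁, hκ₁, hst⟩ := hstart η hη
  have hbudget' : Real.sqrt ((q + η) ^ 2 + Z) + E < Real.sqrt (FluidPDE.Torus.scalarL2Sq θ₀) := by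
    have h := sqrt_sq_add_le hq hη.le hZ0
    rw [hηdef] at h ⊢
    linarith
  -- the `κ`-threshold for the lag conditions (`A = 0`)
  obtain ⟨κ₃, hκ₃, -, hthr₃⟩ := exists_kappa_threshold hr hρ hc i₀
  set κ₀ : ℝ := min κ₁ (min κ₂ κ₃) with hκ₀def
  have hκ₀ : 0 < κ₀ := lt_min hκ₁ (lt_min hκ₂ hκ₃)
  have hκ₀₁ : κ₀ ≤ κ₁ := min_le_left _ _
  have hκ₀₂ : κ₀ ≤ κ₂ := (min_le_right _ _).trans (min_le_left _ _)
  have hκ₀₃ : κ₀ ≤ κ₃ := (min_le_right _ _).trans (min_le_right _ _)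
  have hthr : ∀ κ ∈ Ioc (0 : ℝ) κ₀, i₀ ≤ Jrate r κ + 0 ∧
      1 ≤ 8 * Real.pi ^ 2 * κ * (c * ρ ^ (Jrate r κ + 0)) ^ 2 * tHalf (Jrate r κ + 0) := fun κ hκ => by
    rw [Nat.add_zero]; exact hthr₃ κ hκ.1 (hκ.2.trans hκ₀₃)
  have hstart' : ∀ κ ∈ Ioc (0 : ℝ) κ₀, ∀ w : ℝ → UnitAddTorus (Fin 2) → ℝ,
      FluidPDE.Torus.IsClassicalScalarTransportOn (Ico 0 1) κ P.field w → w 0 = θ₀ →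
        Real.sqrt (∑' k, μH i₀ k ^ 2 * ‖mFourierCoeff (fun x => (w (tStart i₀) x : ℂ)) k‖ ^ 2) ≤ q + η :=
    fun κ hκ w hw h0 => hst κ ⟨hκ.1, hκ.2.trans hκ₀₁⟩ w hw h0
  have hstepH' : ∀ κ ∈ Ioc (0 : ℝ) κ₀, ∀ w : ℝ → UnitAddTorus (Fin 2) → ℝ,
      FluidPDE.Torus.IsClassicalScalarTransportOn (Ico 0 1) κ P.field w → w 0 = θ₀ →
        ∀ j, i₀ ≤ j → j < Jrate r κ + 0 →
          ∑' k, μV j k ^ 2 * ‖mFourierCoeff (fun x => (w (tStart j + tHalf j) x : ℂ)) k‖ ^ 2 ≤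
            (Real.sqrt (∑' k, μH j k ^ 2 * ‖mFourierCoeff (fun x => (w (tStart j) x : ℂ)) k‖ ^ 2) + εH j) ^ 2 + ζH j :=
    fun κ hκ w hw h0 j hj hjJ => hstepH κ ⟨hκ.1, hκ.2.trans hκ₀₂⟩ w hw h0 j hj (by rwa [Nat.add_zero] at hjJ)
  have hstepV' : ∀ κ ∈ Ioc (0 : ℝ) κ₀, ∀ w : ℝ → UnitAddTorus (Fin 2) → ℝ,
      FluidPDE.Torus.IsClassicalScalarTransportOn (Ico 0 1) κ P.field w → w 0 = θ₀ →
        ∀ j, i₀ ≤ j → j < Jrate r κ + 0 →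
          ∑' k, μH (j + 1) k ^ 2 * ‖mFourierCoeff (fun x => (w (tStart (j + 1)) x : ℂ)) k‖ ^ 2 ≤
            (Real.sqrt (∑' k, μV j k ^ 2 * ‖mFourierCoeff (fun x => (w (tStart j + tHalf j) x : ℂ)) k‖ ^ 2) + εV j) ^ 2 +
              ζV j :=
    fun κ hκ w hw h0 j hj hjJ => hstepV κ ⟨hκ.1, hκ.2.trans hκ₀₂⟩ w hw h0 j hj (by rwa [Nat.add_zero] at hjJ)
  exact highModeConcentration_of_ledger_threshold P r hθ₀ μH μV hμH hc hρ0 hlow hεH hεV hζH hζV hE hZ hκ₀ hthr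
    hstart' hstepH' hstepV' hbudget'

/-! ## §3 The same with the ledger socket in existential per-slot form -/

/-- **The geometrically decaying ledger gives the stub's conclusion — existential per-slot errors.**  As
`highModeConcentration_of_geometric_ledger`, but each half-slot inequality is asked with SOME non-negative errors
`ε ≤ K θ^j`, `ζ ≤ K′ θ^j` that may depend on `κ` and `w` (constants `K_ε^H, K_ζ^H` for the H half-slot, `K_ε^V, K_ζ^V` for
the V half-slot); the budget is `√(q² + (K_ζ^H+K_ζ^V)θ^{i₀}/(1−θ)) + (K_ε^H+K_ε^V)θ^{i₀}/(1−θ) < ‖θ₀‖_{L²}`.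
[cite: DEIJ2022, (1.2)–(1.3)] [cite: Grafakos2014, Prop. 3.2.7 (3)] -/
theorem highModeConcentration_of_geometric_ledger' (P : CascadeParams) {r ρ c : ℝ} (hr : 1 < r) (hρ : r < ρ)
    (hc : 0 < c) {θ₀ : UnitAddTorus (Fin 2) → ℝ} (hθ₀ : 0 < FluidPDE.Torus.scalarL2Sq θ₀)
    (μH μV : ℕ → (Fin 2 → ℤ) → ℝ) (hμH : ∀ j k, |μH j k| ≤ 1) {i₀ : ℕ}
    (hlow : ∀ J, i₀ ≤ J → ∀ k : Fin 2 → ℤ, |((k 0 : ℤ) : ℝ)| < c * ρ ^ J → 1 ≤ μH J k ^ 2)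
    {KεH KζH KεV KζV θ : ℝ} (hKεH : 0 ≤ KεH) (hKζH : 0 ≤ KζH) (hKεV : 0 ≤ KεV) (hKζV : 0 ≤ KζV)
    (hθ0 : 0 ≤ θ) (hθ1 : θ < 1) {κ₂ : ℝ} (hκ₂ : 0 < κ₂)
    (hstepH : ∀ κ ∈ Ioc (0 : ℝ) κ₂, ∀ w : ℝ → UnitAddTorus (Fin 2) → ℝ,
      FluidPDE.Torus.IsClassicalScalarTransportOn (Ico 0 1) κ P.field w → w 0 = θ₀ →
        ∀ j, i₀ ≤ j → j < Jrate r κ → ∃ ε ζ : ℝ, 0 ≤ ε ∧ ε ≤ KεH * θ ^ j ∧ 0 ≤ ζ ∧ ζ ≤ KζH * θ ^ j ∧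
          ∑' k, μV j k ^ 2 * ‖mFourierCoeff (fun x => (w (tStart j + tHalf j) x : ℂ)) k‖ ^ 2 ≤
            (Real.sqrt (∑' k, μH j k ^ 2 * ‖mFourierCoeff (fun x => (w (tStart j) x : ℂ)) k‖ ^ 2) + ε) ^ 2 + ζ)
    (hstepV : ∀ κ ∈ Ioc (0 : ℝ) κ₂, ∀ w : ℝ → UnitAddTorus (Fin 2) → ℝ,
      FluidPDE.Torus.IsClassicalScalarTransportOn (Ico 0 1) κ P.field w → w 0 = θ₀ →
        ∀ j, i₀ ≤ j → j < Jrate r κ → ∃ ε ζ : ℝ, 0 ≤ ε ∧ ε ≤ KεV * θ ^ j ∧ 0 ≤ ζ ∧ ζ ≤ KζV * θ ^ j ∧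
          ∑' k, μH (j + 1) k ^ 2 * ‖mFourierCoeff (fun x => (w (tStart (j + 1)) x : ℂ)) k‖ ^ 2 ≤
            (Real.sqrt (∑' k, μV j k ^ 2 * ‖mFourierCoeff (fun x => (w (tStart j + tHalf j) x : ℂ)) k‖ ^ 2) + ε) ^ 2 + ζ)
    {q : ℝ} (hq : 0 ≤ q)
    (hstart : ∀ η : ℝ, 0 < η → ∃ κ₁ : ℝ, 0 < κ₁ ∧ ∀ κ ∈ Ioc (0 : ℝ) κ₁, ∀ w : ℝ → UnitAddTorus (Fin 2) → ℝ,
      FluidPDE.Torus.IsClassicalScalarTransportOn (Ico 0 1) κ P.field w → w 0 = θ₀ →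
        Real.sqrt (∑' k, μH i₀ k ^ 2 * ‖mFourierCoeff (fun x => (w (tStart i₀) x : ℂ)) k‖ ^ 2) ≤ q + η)
    (hbudget : Real.sqrt (q ^ 2 + (KζH + KζV) * θ ^ i₀ / (1 - θ)) + (KεH + KεV) * θ ^ i₀ / (1 - θ) <
      Real.sqrt (FluidPDE.Torus.scalarL2Sq θ₀)) :
    ∃ χ : ℝ, 0 < χ ∧ ∃ A' : ℕ, ∃ κ₀ : ℝ, 0 < κ₀ ∧ ∀ κ ∈ Ioc (0 : ℝ) κ₀,
      ∀ w : ℝ → UnitAddTorus (Fin 2) → ℝ,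
        FluidPDE.Torus.IsClassicalScalarTransportOn (Ico 0 1) κ P.field w → w 0 = θ₀ →
        ∃ K : ℝ, 0 ≤ K ∧ 1 ≤ 8 * Real.pi ^ 2 * κ * K ^ 2 * tHalf (Jrate r κ + A') ∧
          ENNReal.ofReal (2 * χ * FluidPDE.Torus.scalarL2Sq θ₀) ≤
            highModeEnergy 0 K (w (tStart (Jrate r κ + A'))) +
              2 * FluidPDE.Torus.eScalarDissipation κ w 0 (tStart (Jrate r κ + A')) := by
  -- majorise the existential errors by the geometric envelopes
  refine highModeConcentration_of_geometric_ledger P hr hρ hc hθ₀ μH μV hμH hlow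
    (εH := fun j => KεH * θ ^ j) (εV := fun j => KεV * θ ^ j) (ζH := fun j => KζH * θ ^ j)
    (ζV := fun j => KζV * θ ^ j) (fun j => by positivity) (fun j => by positivity) (fun j => by positivity)
    (fun j => by positivity) (Kε := KεH + KεV) (Kζ := KζH + KζV) (by positivity) (by positivity) hθ0 hθ1
    (fun j _ => by ring_nf; rfl) (fun j _ => by ring_nf; rfl) hκ₂ ?_ ?_ hq hstart hbudget
  · intro κ hκ w hw h0 j hj hjJ
    obtain ⟨ε, ζ, hε0, hεK, -, hζK, h⟩ := hstepH κ hκ w hw h0 j hj hjJ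
    exact h.trans (sq_add_le_sq_add (Real.sqrt_nonneg _) hε0 hεK hζK)
  · intro κ hκ w hw h0 j hj hjJ
    obtain ⟨ε, ζ, hε0, hεK, -, hζK, h⟩ := hstepV κ hκ w hw h0 j hj hjJ
    exact h.trans (sq_add_le_sq_add (Real.sqrt_nonneg _) hε0 hεK hζK)

end Summit.AnomalousDissipation.AnomalousDissipation.Theorems.SawtoothPulseCascade.K1Ledger
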